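import Summits.QuantumFields.GaugeBoot.DiagonalRPTorusOdd
import HarnessLib

/-!
# The staircase loop along the mirror of the odd two-torus and the gauge-invariant witness
(gauge-boot, L3(θ) gauge-invariant sector at `β < 0`, 1/3)

HONEST FRAMING (cell `pub-gaugeboot`, page 1 of every file): the venture produces certified bounds
on lattice expectations at stated coupling, gauge group, dimension and torus size; NOT a mass gap,
NOT a continuum limit, NOT a string tension; NOT Yang–Mills-summit-bearing (barriers
`FixedCouplingUltralocality`, `PerturbativeInvisibility`). Bookkeeping for a NEGATIVE structural
result (`DiagonalRPTorusOddGaugeInvariantNegative.lean`: on ODD two-tori at `β < 0` closed-half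
diagonal RP fails even for GAUGE-INVARIANT observables); nothing at `β ≥ 0` changes.

Notation of `DiagonalRPTorusTwoGeometry` / `…OddCrossing` (`kd`, `cT`, `dT`, `rr`, `S0`, `Sp`,
`gObs`). `dg t = (t, t)` is the `t`-th mirror site (`S0_eq_image_dg`); `stairC n U = C_{dg 0} ⋯
C_{dg (n-1)}` the holonomy of the STAIRCASE along the mirror on the closed-half side, `stairD` the
mirrored staircase, `stairM k n` the mixed one (first `k` steps `C`, then `D`), `tailD` its tail;
`stairC n (ΘU) = stairD n U`, `stairC n (U^g) = g(dg 0) stairC n U g(dg n)⁻¹` (so `tr ρ(stairC L U)`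
is gauge invariant); one-link bookkeeping for resampling the link `(dg k, j)` (`stairM_update_dgj`).
★ `stairWitness ρ i j β U = tr ρ(stairC L U) · e^{-β Σ_{y ∈ Sp} r_y(U)}` — THE WITNESS: bounded,
measurable, gauge invariant, an observable of the closed diagonal half (`L ≥ 3`), with
`gObs (stairWitness) = tr ρ ∘ stairC L`. Elementary. [folklore]
-/

open MeasureTheory Complex Finset Function
open scoped ComplexOrder

namespace Summit.QuantumFields.GaugeBoot

open Literature.MathematicalPhysics.QuantumFieldTheory
open Literature.RepresentationTheory.CompactGroups

noncomputable section

namespace DiagRPTwo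

/-! ## The mirror sites `dg t = (t, t)` -/

section MirrorSites

variable {L : ℕ} {i j : Fin 2}

/-- The `t`-th mirror site `(t, t)` of the two-torus. -/
def dg (t : ℕ) : Site 2 L := fun _ => (t : ZMod L)

/-- Mirror sites have diagonal coordinate `0`. -/
@[simp] theorem kd_dg (i j : Fin 2) (t : ℕ) : kd i j (dg t : Site 2 L) = 0 := sub_self _

/-- The swap fixes the mirror sites. -/
@[simp] theorem siteDiagSwap_dg (i j : Fin 2) (t : ℕ) : siteDiagSwap i j (dg t : Site 2 L) = dg t :=
  funext fun _ => rfl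

/-- In `Fin 2`, `i ≠ j` means every index is `i` or `j`. -/
theorem eq_or_eq_of_ne (hij : i ≠ j) (k : Fin 2) : k = i ∨ k = j := by
  rcases Fin.exists_fin_two.mp ⟨k, rfl⟩ with h | h <;> rcases Fin.exists_fin_two.mp ⟨i, rfl⟩ with hi | hi <;>
    rcases Fin.exists_fin_two.mp ⟨j, rfl⟩ with hj | hj <;> simp_all

/-- `dg t + e_i + e_j = dg (t + 1)`. -/
theorem dg_shift_shift (hij : i ≠ j) (t : ℕ) : ((dg t : Site 2 L).shift i).shift j = dg (t + 1) := by
  funext k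
  simp only [Site.shift, dg, Pi.add_apply, Pi.single_apply, Nat.cast_add, Nat.cast_one]
  rcases eq_or_eq_of_ne hij k with rfl | rfl
  · simp [hij]
  · simp [hij.symm]

/-- `dg L = dg 0` on `(ℤ/L)²`: the staircase closes up. -/
@[simp] theorem dg_self (L : ℕ) : (dg L : Site 2 L) = dg 0 := by
  funext k; simp [dg]

/-- `dg` is injective on `[0, L)`. -/
theorem dg_injOn [NeZero L] : Set.InjOn (dg : ℕ → Site 2 L) (Finset.range L : Set ℕ) := by
  intro s hs t ht h
  have h0 := congrFun h 0
  simp only [dg] at h0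
  have := congrArg ZMod.val h0
  rwa [ZMod.val_natCast, ZMod.val_natCast, Nat.mod_eq_of_lt (Finset.mem_range.1 hs),
    Nat.mod_eq_of_lt (Finset.mem_range.1 ht)] at this

/-- A mirror site is `dg` of its `i`-coordinate. -/
theorem eq_dg_of_kd_eq_zero [NeZero L] (hij : i ≠ j) {y : Site 2 L} (hy : kd i j y = 0) :
    y = dg (y i).val := by
  have h : y i = y j := sub_eq_zero.1 hy
  funext k
  simp only [dg, ZMod.natCast_zmod_val]
  rcases eq_or_eq_of_ne hij k with rfl | rfl
  · rfl
  · exact h.symm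

/-- The mirror plaquettes are exactly the `dg t`, `t < L`. -/
theorem S0_eq_image_dg [NeZero L] (hij : i ≠ j) : S0 (L := L) i j = (Finset.range L).image dg := by
  ext y
  rw [mem_S0, Finset.mem_image]
  constructor
  · intro hy
    have hk : kd i j y = 0 := by
      rw [← ZMod.val_eq_zero]; exact hy
    exact ⟨(y i).val, Finset.mem_range.2 (ZMod.val_lt _), (eq_dg_of_kd_eq_zero hij hk).symm⟩
  · rintro ⟨t, -, rfl⟩
    rw [kd_dg, ZMod.val_zero]

/-- Sums over the mirror plaquettes are sums over `t < L`. -/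
theorem sum_S0_eq_sum_range [NeZero L] (hij : i ≠ j) {M : Type*} [AddCommMonoid M] (f : Site 2 L → M) :
    ∑ y ∈ S0 i j, f y = ∑ t ∈ Finset.range L, f (dg t) := by
  rw [S0_eq_image_dg hij, Finset.sum_image fun s hs t ht h => dg_injOn hs ht h]

/-- The first `C`-link of a mirror transport is never the `j`-link at a mirror site. -/
theorem dgi_ne_dgj (hij : i ≠ j) (t k : ℕ) : ((dg t : Site 2 L), i) ≠ (dg k, j) :=
  fun h => hij (congrArg Prod.snd h)

/-- The second `C`-link of a mirror transport is never the `j`-link at a mirror site (it starts on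
the layer `k = 1`; `L ≥ 2`). -/
theorem dgshift_ne_dgj [NeZero L] (h2 : 2 ≤ L) (hij : i ≠ j) (t k : ℕ) :
    (((dg t : Site 2 L).shift i), j) ≠ (dg k, j) := by
  intro h
  have h1 := congrArg (fun e : Edge 2 L => kd i j e.1) h
  simp only [kd_shift_left hij, kd_dg, zero_add] at h1
  haveI : Fact (1 < L) := ⟨by omega⟩
  exact one_ne_zero h1

/-- The second `D`-link of a mirror transport is never the `j`-link at a mirror site. -/
theorem dgshiftj_ne_dgj (hij : i ≠ j) (t k : ℕ) : (((dg t : Site 2 L).shift j), i) ≠ (dg k, j) :=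
  fun h => hij (congrArg Prod.snd h)

/-- Distinct mirror sites have distinct `j`-links (`t, k < L`). -/
theorem dgj_ne_dgj [NeZero L] {t k : ℕ} (ht : t < L) (hk : k < L) (htk : t ≠ k) :
    ((dg t : Site 2 L), j) ≠ (dg k, j) := fun h =>
  htk (dg_injOn (Finset.mem_coe.2 (Finset.mem_range.2 ht)) (Finset.mem_coe.2 (Finset.mem_range.2 hk))
    (congrArg Prod.fst h))

end MirrorSites

/-! ## The staircase holonomies -/

section Staircase

variable {L : ℕ} {G : Type*} [Group G] (i j : Fin 2)

/-- `stairC n U = C_{dg 0} C_{dg 1} ⋯ C_{dg (n-1)}`: the holonomy of the staircase along the mirror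
on the closed-half side (first `n` steps; `n = L` is the closed loop). -/
def stairC (n : ℕ) (U : GaugeConfig 2 L G) : G := ((List.range n).map fun t => cT i j U (dg t)).prod

/-- `stairD n U = D_{dg 0} ⋯ D_{dg (n-1)}`: the mirrored staircase. -/
def stairD (n : ℕ) (U : GaugeConfig 2 L G) : G := ((List.range n).map fun t => dT i j U (dg t)).prod

/-- The mixed staircase: the first `k` steps along `C`, the remaining ones along `D`. -/
def stairM (k n : ℕ) (U : GaugeConfig 2 L G) : G :=
  ((List.range n).map fun t => if t < k then cT i j U (dg t) else dT i j U (dg t)).prod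

variable {i j}

/-- No steps. -/
@[simp] theorem stairC_zero (U : GaugeConfig 2 L G) : stairC i j 0 U = 1 := by simp [stairC]
/-- No steps. -/
@[simp] theorem stairD_zero (U : GaugeConfig 2 L G) : stairD i j 0 U = 1 := by simp [stairD]
/-- No steps. -/
@[simp] theorem stairM_zero (k : ℕ) (U : GaugeConfig 2 L G) : stairM i j k 0 U = 1 := by simp [stairM]

/-- One more step. -/
theorem stairC_succ (n : ℕ) (U : GaugeConfig 2 L G) :
    stairC i j (n + 1) U = stairC i j n U * cT i j U (dg n) := by
  simp [stairC, List.range_succ, List.map_append, List.prod_append]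

/-- One more step. -/
theorem stairD_succ (n : ℕ) (U : GaugeConfig 2 L G) :
    stairD i j (n + 1) U = stairD i j n U * dT i j U (dg n) := by
  simp [stairD, List.range_succ, List.map_append, List.prod_append]

/-- One more step. -/
theorem stairM_succ (k n : ℕ) (U : GaugeConfig 2 L G) :
    stairM i j k (n + 1) U =
      stairM i j k n U * (if n < k then cT i j U (dg n) else dT i j U (dg n)) := by
  simp [stairM, List.range_succ, List.map_append, List.prod_append]

/-- No `C`-steps: the mixed staircase is the mirrored one. -/
theorem stairM_zero_left (n : ℕ) (U : GaugeConfig 2 L G) : stairM i j 0 n U = stairD i j n U := by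
  induction n with
  | zero => simp
  | succ n ih => rw [stairM_succ, stairD_succ, ih]; simp

/-- Only `C`-steps: the mixed staircase is the staircase. -/
theorem stairM_of_le {k n : ℕ} (h : n ≤ k) (U : GaugeConfig 2 L G) : stairM i j k n U = stairC i j n U := by
  induction n with
  | zero => simp
  | succ n ih =>
    rw [stairM_succ, stairC_succ, ih (Nat.le_of_succ_le h), if_pos (Nat.lt_of_succ_le h)]

/-- The tail of the mirrored staircase after the step `k`: `D_{dg (k+1)} ⋯ D_{dg (n-1)}` (trivial
factors for `t ≤ k`, so that it is defined for every `n`). -/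
def tailD (i j : Fin 2) (k n : ℕ) (U : GaugeConfig 2 L G) : G :=
  ((List.range n).map fun t => if k < t then dT i j U (dg t) else 1).prod

/-- No steps. -/
@[simp] theorem tailD_zero (k : ℕ) (U : GaugeConfig 2 L G) : tailD i j k 0 U = 1 := by simp [tailD]

/-- One more step of the tail. -/
theorem tailD_succ (k n : ℕ) (U : GaugeConfig 2 L G) :
    tailD i j k (n + 1) U = tailD i j k n U * (if k < n then dT i j U (dg n) else 1) := by
  simp [tailD, List.range_succ, List.map_append, List.prod_append]

/-- The tail is trivial up to the step `k`. -/
theorem tailD_of_le {k n : ℕ} (h : n ≤ k) (U : GaugeConfig 2 L G) : tailD i j k n U = 1 := by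
  induction n with
  | zero => simp
  | succ n ih => rw [tailD_succ, ih (Nat.le_of_succ_le h), if_neg (by omega), mul_one]

/-- ★ **Splitting the mixed staircases at the step `k < n`**:
`stairM k n = stairC k · D_{dg k} · tailD k n` and `stairM (k+1) n = stairC k · C_{dg k} · tailD k n`. -/
theorem stairM_split {k n : ℕ} (hk : k < n) (U : GaugeConfig 2 L G) :
    stairM i j k n U = stairC i j k U * dT i j U (dg k) * tailD i j k n U ∧
      stairM i j (k + 1) n U = stairC i j k U * cT i j U (dg k) * tailD i j k n U := by
  induction n with
  | zero => exact absurd hk (Nat.not_lt_zero _)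
  | succ n ih =>
    rcases Nat.lt_succ_iff_lt_or_eq.1 hk with hlt | rfl
    · obtain ⟨h1, h2⟩ := ih hlt
      refine ⟨?_, ?_⟩
      · rw [stairM_succ, h1, if_neg (by omega), tailD_succ, if_pos hlt]; simp [mul_assoc]
      · rw [stairM_succ, h2, if_neg (by omega), tailD_succ, if_pos hlt]; simp [mul_assoc]
    · refine ⟨?_, ?_⟩
      · rw [stairM_succ, if_neg (lt_irrefl k), stairM_of_le le_rfl, tailD_succ, if_neg (lt_irrefl k),
          tailD_of_le le_rfl, mul_one, mul_one]
      · rw [stairM_succ, if_pos (Nat.lt_succ_self k), stairM_of_le (Nat.le_succ k),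
          tailD_succ, if_neg (lt_irrefl k), tailD_of_le le_rfl, mul_one, mul_one]

/-- The swap turns the staircase into the mirrored staircase. -/
theorem stairC_configDiagSwap (n : ℕ) (U : GaugeConfig 2 L G) :
    stairC i j n (configDiagSwap i j U) = stairD i j n U := by
  induction n with
  | zero => simp
  | succ n ih => rw [stairC_succ, stairD_succ, ih, cT_configDiagSwap, siteDiagSwap_dg]

/-- A mirror transport under a gauge transformation. -/
theorem cT_gaugeTransform (g : Site 2 L → G) (U : GaugeConfig 2 L G) (y : Site 2 L) :
    cT i j (gaugeTransform g U) y = g y * cT i j U y * (g ((y.shift i).shift j))⁻¹ := by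
  simp only [cT, gaugeTransform]
  group

/-- The staircase under a gauge transformation: conjugation at its two ends. -/
theorem stairC_gaugeTransform (hij : i ≠ j) (g : Site 2 L → G) (n : ℕ) (U : GaugeConfig 2 L G) :
    stairC i j n (gaugeTransform g U) = g (dg 0) * stairC i j n U * (g (dg n))⁻¹ := by
  induction n with
  | zero => simp
  | succ n ih => rw [stairC_succ, stairC_succ, ih, cT_gaugeTransform, dg_shift_shift hij]; group

/-- ★ **The closed staircase has gauge-invariant character** (any function of the conjugacy class). -/
theorem trace_stairC_gaugeTransform {N : ℕ} (ρ : G →* Matrix (Fin N) (Fin N) ℂ) (hij : i ≠ j)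
    (g : Site 2 L → G) (U : GaugeConfig 2 L G) :
    (ρ (stairC i j L (gaugeTransform g U))).trace = (ρ (stairC i j L U)).trace := by
  rw [stairC_gaugeTransform hij, dg_self, CompactGroup.trace_conj_eq]

/-! ### Resampling the link `(dg k, j)` -/

variable [NeZero L]

/-- The mirror transports `C` do not read the link `(dg k, j)` (`L ≥ 2`). -/
theorem cT_update_dgj (h2 : 2 ≤ L) (hij : i ≠ j) (U : GaugeConfig 2 L G) (k t : ℕ) (s : G) :
    cT i j (Function.update U (dg k, j) s) (dg t) = cT i j U (dg t) := by
  simp only [cT, Function.update_of_ne (dgi_ne_dgj hij t k),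
    Function.update_of_ne (dgshift_ne_dgj h2 hij t k)]

/-- The other mirror transports `D_{dg t}`, `t ≠ k`, do not read the link `(dg k, j)`. -/
theorem dT_update_dgj_of_ne (hij : i ≠ j) (U : GaugeConfig 2 L G) {k t : ℕ} (hk : k < L)
    (ht : t < L) (htk : t ≠ k) (s : G) :
    dT i j (Function.update U (dg k, j) s) (dg t) = dT i j U (dg t) := by
  simp only [dT, Function.update_of_ne (dgj_ne_dgj ht hk htk),
    Function.update_of_ne (dgshiftj_ne_dgj hij t k)]

omit [NeZero L] in
/-- `D_{dg k}` after resampling its first link: `s · U(dg k + e_j, i)`. -/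
theorem dT_update_dgj_self (hij : i ≠ j) (U : GaugeConfig 2 L G) (k : ℕ) (s : G) :
    dT i j (Function.update U (dg k, j) s) (dg k) = s * U ((dg k : Site 2 L).shift j, i) := by
  simp only [dT, Function.update_self, Function.update_of_ne (dgshiftj_ne_dgj hij k k)]

/-- The staircase does not read the link `(dg k, j)`. -/
theorem stairC_update_dgj (h2 : 2 ≤ L) (hij : i ≠ j) (n : ℕ) (U : GaugeConfig 2 L G) (k : ℕ) (s : G) :
    stairC i j n (Function.update U (dg k, j) s) = stairC i j n U := by
  induction n with
  | zero => simp
  | succ n ih => rw [stairC_succ, stairC_succ, ih, cT_update_dgj h2 hij]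

/-- The tail does not read the link `(dg k, j)` (`n ≤ L`). -/
theorem tailD_update_dgj (hij : i ≠ j) {k n : ℕ} (hk : k < L) (hn : n ≤ L) (U : GaugeConfig 2 L G)
    (s : G) : tailD i j k n (Function.update U (dg k, j) s) = tailD i j k n U := by
  induction n with
  | zero => simp
  | succ n ih =>
    rw [tailD_succ, tailD_succ, ih (Nat.le_of_succ_le hn)]
    by_cases hkn : k < n
    · rw [if_pos hkn, if_pos hkn, dT_update_dgj_of_ne hij U hk (Nat.lt_of_succ_le hn) (Nat.ne_of_gt hkn)]
    · rw [if_neg hkn, if_neg hkn]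

/-- ★ **The resampling step on the mixed staircases** (`k < L`, `L ≥ 2`, `u = U(dg k + e_j, i)`):
`stairM k L (U[(dg k,j) ↦ s]) = stairC k U · (s u) · tailD k L U`,
`stairM (k+1) L (U[(dg k,j) ↦ s]) = stairM (k+1) L U = stairC k U · C_{dg k}(U) · tailD k L U`. -/
theorem stairM_update_dgj (h2 : 2 ≤ L) (hij : i ≠ j) {k : ℕ} (hk : k < L) (U : GaugeConfig 2 L G)
    (s : G) :
    stairM i j k L (Function.update U (dg k, j) s) =
        stairC i j k U * (s * U ((dg k : Site 2 L).shift j, i)) * tailD i j k L U ∧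
      stairM i j (k + 1) L (Function.update U (dg k, j) s) = stairM i j (k + 1) L U ∧
      stairM i j (k + 1) L U = stairC i j k U * cT i j U (dg k) * tailD i j k L U := by
  obtain ⟨hA, hB⟩ := stairM_split (i := i) (j := j) hk (Function.update U (dg k, j) s)
  obtain ⟨-, h4⟩ := stairM_split (i := i) (j := j) hk U
  rw [stairC_update_dgj h2 hij, tailD_update_dgj hij hk le_rfl] at hA hB
  rw [dT_update_dgj_self hij] at hA
  rw [cT_update_dgj h2 hij] at hB
  exact ⟨hA, hB.trans h4.symm, h4⟩

end Staircase

/-! ## The witness -/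

section Witness

variable {L N : ℕ} [NeZero L] {G : Type*} [Group G] [TopologicalSpace G] [IsTopologicalGroup G]
  [CompactSpace G] (ρ : G →* Matrix (Fin N) (Fin N) ℂ) (i j : Fin 2)

/-- ★ **THE GAUGE-INVARIANT WITNESS** `F(U) = tr ρ(stairC L U) · exp(-β Σ_{y ∈ Sp} r_y(U))`: the
character of the closed staircase along the mirror times the inverse interior Boltzmann weight of
the closed half (so that `gObs F = tr ρ ∘ stairC L`). -/
def stairWitness (β : ℝ) (U : GaugeConfig 2 L G) : ℂ :=
  (ρ (stairC i j L U)).trace * (Real.exp (-(β * ∑ y ∈ Sp i j, rr ρ i j U y)) : ℂ)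

variable {i j}

omit [TopologicalSpace G] [IsTopologicalGroup G] [CompactSpace G] in
/-- `gObs F = tr ρ ∘ stairC L`. -/
theorem gObs_stairWitness (β : ℝ) (U : GaugeConfig 2 L G) :
    gObs ρ i j β (stairWitness ρ i j β) U = (ρ (stairC i j L U)).trace := by
  rw [gObs, stairWitness, mul_assoc, ← Complex.ofReal_mul, ← Real.exp_add, neg_add_cancel,
    Real.exp_zero, Complex.ofReal_one, mul_one]

omit [TopologicalSpace G] [IsTopologicalGroup G] [CompactSpace G] in
/-- ★ The witness is gauge invariant. -/
theorem isGaugeInvariant_stairWitness (hij : i ≠ j) (β : ℝ) :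
    IsGaugeInvariant (stairWitness (L := L) ρ i j β) := by
  intro g U
  simp only [stairWitness, trace_stairC_gaugeTransform ρ hij, rr_gaugeTransform]

omit [TopologicalSpace G] [IsTopologicalGroup G] [CompactSpace G] in
/-- ★ The witness is an observable of the closed diagonal half (`L ≥ 3`: the mirror transports
and the interior plaquettes of the half lie in the closed half). -/
theorem isDiagonalHalfObservable_stairWitness (h3 : 3 ≤ L) (hij : i ≠ j) (β : ℝ) :
    IsDiagonalHalfObservable i j (stairWitness (L := L) ρ i j β) := by
  intro U V hUV
  have hUV' : ∀ e : Edge 2 L, InHalf i j e → U e = V e := fun e he => hUV e he.1 he.2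
  have hC : ∀ t, cT i j U (dg t) = cT i j V (dg t) := fun t => by
    obtain ⟨h1, h2⟩ := inHalf_cT_links' h3 hij (kd_dg i j t)
    simp only [cT, hUV' _ h1, hUV' _ h2]
  have hS : stairC i j L U = stairC i j L V := by
    simp only [stairC]
    exact congrArg _ (List.map_congr_left fun t _ => hC t)
  have hSum : ∑ y ∈ Sp i j, rr ρ i j U y = ∑ y ∈ Sp i j, rr ρ i j V y :=
    dependsOn_sum_rr ρ i j (Sp i j) fun e he => hUV' e (by
      obtain ⟨y, hy, hey⟩ := Finset.mem_biUnion.1 he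
      exact inHalf_blk' h3 hij hy hey)
  simp only [stairWitness, hS, hSum]

end Witness

end DiagRPTwo

end

end Summit.QuantumFields.GaugeBoot
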